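import Summits.CriticalPhenomena.PercolationContinuityZ3.Theorems.PercNearOneGluingNoHeavyConstsMarkerSplit
import Summits.CriticalPhenomena.PercolationContinuityZ3.Theorems.PercNearOneGluingNoHeavyLowerTailFKExactEval
import Summits.CriticalPhenomena.PercolationContinuityZ3.Theorems.PercNearOneGluingNoHeavyConstsCrossReachMeasureRefutation
import HarnessLib

/-!
# REFUTATION of the marker-split conjecture `Consts.MarkerSplit` (S0): an exact five-vertex counterexample with `X = ∅`
# (PAPER-2 track (ii); seat `prim-consts-2`, gen 16 — same seat, same day as the conjecture)

builds on p205010 (kernel theorem, internal audit signed; external expert review pending).  Support file (`--supports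
stmt-CriticalPhenomena-4575`); evidence `CEX-MarkerSplit-g16.md` on stmt-4575; memo `run/shared/lean/prim/consts/FROM-prim-consts-2-g16-MARKER-SPLIT.md` §0(4′).
Every number below is an exact rational decided by the KERNEL (`decide +kernel`; no `native_decide`); no definitions of mathematical content
(only Boolean event predicates on the `2⁶` configurations of the listed pairs and a cheap mass function), no named facts, no sorries.

THE CONJECTURE (`Consts.MarkerSplit`, typed in `…ConstsMarkerSplit.lean`, p352373): for every monotone `0 ≤ F ≤ 1` of `C_s`,
`K·C2 ≥ I·C0` (notation of that file); for `F = 1_U`: `Cov_ν(U, Y∩Z) ≥ (p' + ν(Z | Uᶜ, N))·Cov_ν(U, Y)`.  It implies MDL(X)′ at the same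
functional and was supported by an exact census with `0` violations in `> 1.5·10⁵` (instance, up-event) pairs (`n ≤ 7`, generic/corner/dense
palettes) — but it is FALSE: a corner-seeking hill-climb on the weights (seeded at a `10⁻¹⁰`-violation of a sibling form found at `n = 7`)
produced the witness below, then deletion of three edges and the avoided vertex simplified it to FIVE vertices and NO avoided set.
THE WITNESS: `V = Fin 5`, owner `s = 0`, markers `y = 1`, `z = 2`, `X = ∅`; pairs `14, 03, 02, 23, 34, 04` with weights
`1/2, 1/2, 7/8, 1/2, 31/32, 3/4`; functional `F = 1{s(0,3) ∈ C}` (the cylinder of the single edge `03` at the owner — the "pair form" class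
PF of memo g10/g11).  With all masses over `8192` (`T = {1 ↮ 0}`, `W = {1 ↔ 2}`, `Y = {0 ↔ 1}`, `Z = {0 ↔ 2}`, `O = {03 open}`):
`I = K = 4096`, `μ(T) = 4407`, `μ(T∩W) = 31`, `K_N = μ(N∩Oᶜ) = 2343`, `K_{N∩Z} = 2116`, `K_Y = 1753`, `K_{Y∩Z} = 1654`, `I_Y = 2032`, `I_{Y∩Z} = 1905`,
and `I·C0 − K·C2 = 3784113/2³⁷ > 0` (`Consts.MarkerSplitCex.markerSplit_lt`): in covariance form `Cov(U,Y∩Z)/Cov(U,Y) = 251/279 = 0.8996 <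
p' + ν(Z|Uᶜ,N) = 31/4407 + 2116/2343 = 0.9102`.  MDL(X)′ itself HOLDS at the witness (`MDLX(U) = +0.0042·Cov(U,Y)`): the positive-association
term `(b₁ − b₀)ν(N|U)` of the split identity (`Consts.mdlx_markerSplit_identity`) is load-bearing — S0 fails exactly by dropping it.
CONSEQUENCES: the split identity, `Consts.conditionedMarker_ge` (C2 ≥ 0), `Consts.mdlxJoint_of_markerSplit` (S0 ⟹ MDL(X)′, functional by
functional), `Consts.mdlxJoint_of_lowerMarker_le` and `Consts.mdlxJoint_of_markerBound` are theorems and untouched; what dies is the hope that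
the PA term can be dropped.  The sibling pure-`ε` forms of the memo (constants `P(Z∪W | Uᶜ,T)`, `p' + P(Z|Uᶜ,T)`) are false too (n = 7 resp. this
witness; memo §0(5′)).  CLASSIFICATION: refuted-substantive (house conjecture, one day old); no repair with a `U`-independent or
`Uᶜ∩N`-measurable constant exists (all such variants have exact counterexamples); `Consts.MDLXJoint` is not touched.
METHOD: as in `…ConstsThreeSepNegative.lean` — `FK.RCEval` at `q = 1` (`rcMeasureW w 1 ∅ = prodBernoulli w`), masses as `64`-term sums of products of
six rationals, events read by `FK.RCEval.reachB` (`reachB_iff`) and edge membership.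
[cite: VandenbergHaggstromKahn2005, Thm. 1.3 (p. 6); §2.1 pp. 10–13] [cite: Grimmett2006, §1.4 eq. (1.20) (p. 15)]
-/

namespace Summit.CriticalPhenomena.PercolationContinuityZ3.Theorems

namespace Consts

open MeasureTheory Literature.Probability.LatticeModels Literature.Probability.Percolation

namespace MarkerSplitCex

/-- The witness as listed data: five vertices, pairs `14, 03, 02, 23, 34, 04` with weights `1/2, 1/2, 7/8, 1/2, 31/32, 3/4`, `q = 1`.
(this seat, gen 16) -/
abbrev G : FK.RCEval := ⟨5, 6, ![1, 0, 0, 2, 3, 0], ![4, 3, 2, 3, 4, 4], ![1 / 2, 1 / 2, 7 / 8, 1 / 2, 31 / 32, 3 / 4], 1⟩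

/-- The listing is valid. [folklore] -/
theorem G_valid : G.Valid := by decide +kernel

/-! ### Cheap masses and the event predicates -/

/-- `Σ_t [P t] · ∏_i (c_i or 1 − c_i)` (computable, no cluster count). [folklore] -/
def massW (P : Finset (Fin 6) → Bool) : ℚ := ∑ t : Finset (Fin 6), if P t then G.wQ t else 0

/-- At `q = 1`, `massQ = massW`. [folklore] -/
theorem massQ_eq_massW (P : Finset (Fin 6) → Bool) : G.massQ P = massW P := by
  unfold FK.RCEval.massQ massW FK.RCEval.mQ
  refine Finset.sum_congr rfl fun t _ => ?_
  have hq : G.q = 1 := rfl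
  rw [hq, one_pow, mul_one]

/-- At `q = 1`, `ZQ = Σ_t wQ t`. [folklore] -/
theorem zq_eq : G.ZQ = massW (fun _ => true) := by
  unfold FK.RCEval.ZQ massW FK.RCEval.mQ
  refine Finset.sum_congr rfl fun t _ => ?_
  have hq : G.q = 1 := rfl
  rw [hq, one_pow, mul_one, if_pos rfl]

/-- the edge `03` (index `1`) is open -/
def pO (t : Finset (Fin 6)) : Bool := decide ((1 : Fin 6) ∈ t)
/-- `I`: `O` -/
def pI (t : Finset (Fin 6)) : Bool := pO t
/-- `K`: `Oᶜ` -/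
def pK (t : Finset (Fin 6)) : Bool := !pO t
/-- `T = {1 ↮ 0}` -/
def pT (t : Finset (Fin 6)) : Bool := !G.reachB t 1 0
/-- `T ∩ W` -/
def pTW (t : Finset (Fin 6)) : Bool := !G.reachB t 1 0 && G.reachB t 1 2
/-- `K_N`: `{0 ↮ 1} ∩ Oᶜ` -/
def pKN (t : Finset (Fin 6)) : Bool := !G.reachB t 0 1 && !pO t
/-- `K_{Y∩Z}`: `{0↔1} ∩ {0↔2} ∩ Oᶜ` -/
def pKYZ (t : Finset (Fin 6)) : Bool := (G.reachB t 0 1 && G.reachB t 0 2) && !pO t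
/-- `K_{N∩Z}`: `{0↮1} ∩ {0↔2} ∩ Oᶜ` -/
def pKNZ (t : Finset (Fin 6)) : Bool := (!G.reachB t 0 1 && G.reachB t 0 2) && !pO t
/-- `K_Y`: `{0↔1} ∩ Oᶜ` -/
def pKY (t : Finset (Fin 6)) : Bool := G.reachB t 0 1 && !pO t
/-- `I_{Y∩Z}`: `{0↔1} ∩ {0↔2} ∩ O` -/
def pIYZ (t : Finset (Fin 6)) : Bool := (G.reachB t 0 1 && G.reachB t 0 2) && pO t
/-- `I_Y`: `{0↔1} ∩ O` -/
def pIY (t : Finset (Fin 6)) : Bool := G.reachB t 0 1 && pO t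

/-! ### Kernel arithmetic (`decide +kernel`, `2⁶` configurations each) -/

set_option maxHeartbeats 0 in
/-- `Z = 1`. [folklore] -/
theorem massW_true : massW (fun _ => true) = 1 := by decide +kernel
set_option maxHeartbeats 0 in
/-- mass of `O`. (this seat, gen 16; two independent exact engines agree) -/
theorem mass_I : massW pI = 4096 / 8192 := by decide +kernel
set_option maxHeartbeats 0 in
/-- mass of `Oᶜ`. -/
theorem mass_K : massW pK = 4096 / 8192 := by decide +kernel
set_option maxHeartbeats 0 in
/-- mass of `T`. -/
theorem mass_T : massW pT = 4407 / 8192 := by decide +kernel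
set_option maxHeartbeats 0 in
/-- mass of `T ∩ W`. -/
theorem mass_TW : massW pTW = 31 / 8192 := by decide +kernel
set_option maxHeartbeats 0 in
/-- mass of `N ∩ Oᶜ`. -/
theorem mass_KN : massW pKN = 2343 / 8192 := by decide +kernel
set_option maxHeartbeats 0 in
/-- mass of `Y ∩ Z ∩ Oᶜ`. -/
theorem mass_KYZ : massW pKYZ = 1654 / 8192 := by decide +kernel
set_option maxHeartbeats 0 in
/-- mass of `N ∩ Z ∩ Oᶜ`. -/
theorem mass_KNZ : massW pKNZ = 2116 / 8192 := by decide +kernel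
set_option maxHeartbeats 0 in
/-- mass of `Y ∩ Oᶜ`. -/
theorem mass_KY : massW pKY = 1753 / 8192 := by decide +kernel
set_option maxHeartbeats 0 in
/-- mass of `Y ∩ Z ∩ O`. -/
theorem mass_IYZ : massW pIYZ = 1905 / 8192 := by decide +kernel
set_option maxHeartbeats 0 in
/-- mass of `Y ∩ O`. -/
theorem mass_IY : massW pIY = 2032 / 8192 := by decide +kernel

/-! ### From Booleans to the events of the statement -/

/-- Reachability in the listed configuration as a Boolean. [folklore] -/
theorem reach_iff (t : Finset (Fin 6)) (a b : Fin 5) :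
    (openGraph (V := Fin 5) (G.conf t)).Reachable a b ↔ G.reachB t a b = true :=
  (FK.RCEval.reachB_iff (D := G) t a b).symm

/-- The edge `03` is open in the listed configuration iff its index `1` is selected. [folklore] -/
theorem open03_iff' (t : Finset (Fin 6)) : s((0 : Fin 5), (3 : Fin 5)) ∈ G.conf t ↔ pO t = true := by
  unfold pO FK.RCEval.conf
  rw [Finset.mem_coe, Finset.mem_image, decide_eq_true_iff]
  constructor
  · rintro ⟨i, hi, he⟩
    have key : ∀ j : Fin 6, G.edge j = s((0 : Fin 5), (3 : Fin 5)) → j = 1 := by decide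
    rw [← key i he]; exact hi
  · intro h; exact ⟨1, h, by decide⟩

/-- The trivial avoided-set event (`X = ∅`) and the three-way separation event `{1 ↮ 0}`. [folklore] -/
theorem mem_univ_iff (ω : BondConfig (Fin 5)) :
    (ω ∈ {ω : BondConfig (Fin 5) | ∀ x ∈ (∅ : Set (Fin 5)), ¬ (openGraph ω).Reachable 0 x}) ↔ True := by
  simp only [Set.mem_setOf_eq, Set.mem_empty_iff_false, false_imp_iff, imp_true_iff]

/-- The three-way separation event at `X = ∅`: `{1 ↮ 0}`. [folklore] -/
theorem mem_A_iff (ω : BondConfig (Fin 5)) :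
    (ω ∈ {ω : BondConfig (Fin 5) | ∀ x ∈ insert (0 : Fin 5) (∅ : Set (Fin 5)), ¬ (openGraph ω).Reachable 1 x}) ↔
      ¬ (openGraph ω).Reachable 1 0 := by
  simp only [Set.mem_setOf_eq, Set.mem_insert_iff, Set.mem_empty_iff_false, or_false, forall_eq]

-- abbreviations for the sets of the instantiated conjecture
/-- `D = {0 ↮ ∅}` (everything). -/
abbrev sD : Set (BondConfig (Fin 5)) := {ω | ∀ x ∈ (∅ : Set (Fin 5)), ¬ (openGraph ω).Reachable 0 x}
/-- `𝒜 = {1 ↮ {0}}`. -/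
abbrev sA : Set (BondConfig (Fin 5)) := {ω | ∀ x ∈ insert (0 : Fin 5) (∅ : Set (Fin 5)), ¬ (openGraph ω).Reachable 1 x}
/-- `O = {03 open}`. -/
abbrev sO : Set (BondConfig (Fin 5)) := {ω | s((0 : Fin 5), (3 : Fin 5)) ∈ ω}

/-- Membership in `O` read by `pO`. [folklore] -/
theorem open03_iff (t : Finset (Fin 6)) : G.conf t ∈ sO ↔ pO t = true := by
  rw [Set.mem_setOf_eq]; exact open03_iff' t

/-- Membership in `O` (the `I`-event). -/
theorem mem_I (t : Finset (Fin 6)) : G.conf t ∈ (sD ∩ sO) ↔ pI t = true := by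
  rw [Set.mem_inter_iff, mem_univ_iff, true_and]; exact open03_iff t
/-- Membership in `Oᶜ` (the `K`-event). -/
theorem mem_K (t : Finset (Fin 6)) : G.conf t ∈ (sD ∩ sOᶜ) ↔ pK t = true := by
  rw [Set.mem_inter_iff, mem_univ_iff, true_and, Set.mem_compl_iff, CrossReachMeasureCex.not_iff_bnot (open03_iff t)]; rfl
/-- Membership in `T`. -/
theorem mem_T (t : Finset (Fin 6)) : G.conf t ∈ (sA ∩ sD) ↔ pT t = true := by
  rw [Set.mem_inter_iff, mem_univ_iff, and_true, mem_A_iff, CrossReachMeasureCex.not_iff_bnot (reach_iff t 1 0)]; rfl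
/-- Membership in `T ∩ W`. -/
theorem mem_TW (t : Finset (Fin 6)) : G.conf t ∈ (sA ∩ sD ∩ openConn 1 2) ↔ pTW t = true := by
  rw [Set.mem_inter_iff, Set.mem_inter_iff, mem_univ_iff, and_true, mem_A_iff, CrossReachMeasureCex.not_iff_bnot (reach_iff t 1 0)]
  unfold pTW openConn; rw [Set.mem_setOf_eq, reach_iff, Bool.and_eq_true]
/-- Membership in `N ∩ Oᶜ`. -/
theorem mem_KN (t : Finset (Fin 6)) : G.conf t ∈ (sD ∩ (openConn 0 1)ᶜ ∩ sOᶜ) ↔ pKN t = true := by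
  rw [Set.mem_inter_iff, Set.mem_inter_iff, mem_univ_iff, true_and, Set.mem_compl_iff, Set.mem_compl_iff,
    CrossReachMeasureCex.not_iff_bnot (open03_iff t)]
  unfold pKN openConn; rw [Set.mem_setOf_eq, CrossReachMeasureCex.not_iff_bnot (reach_iff t 0 1), Bool.and_eq_true]
/-- Membership in `Y ∩ Z ∩ Oᶜ`. -/
theorem mem_KYZ (t : Finset (Fin 6)) : G.conf t ∈ (sD ∩ openConn 0 1 ∩ openConn 0 2 ∩ sOᶜ) ↔ pKYZ t = true := by
  rw [Set.mem_inter_iff, Set.mem_inter_iff, Set.mem_inter_iff, mem_univ_iff, true_and, Set.mem_compl_iff,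
    CrossReachMeasureCex.not_iff_bnot (open03_iff t)]
  unfold pKYZ openConn; rw [Set.mem_setOf_eq, Set.mem_setOf_eq, reach_iff, reach_iff, Bool.and_eq_true, Bool.and_eq_true]
/-- Membership in `N ∩ Z ∩ Oᶜ`. -/
theorem mem_KNZ (t : Finset (Fin 6)) : G.conf t ∈ (sD ∩ (openConn 0 1)ᶜ ∩ openConn 0 2 ∩ sOᶜ) ↔ pKNZ t = true := by
  rw [Set.mem_inter_iff, Set.mem_inter_iff, Set.mem_inter_iff, mem_univ_iff, true_and, Set.mem_compl_iff, Set.mem_compl_iff,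
    CrossReachMeasureCex.not_iff_bnot (open03_iff t)]
  unfold pKNZ openConn; rw [Set.mem_setOf_eq, Set.mem_setOf_eq, CrossReachMeasureCex.not_iff_bnot (reach_iff t 0 1), reach_iff, Bool.and_eq_true, Bool.and_eq_true]
/-- Membership in `Y ∩ Oᶜ`. -/
theorem mem_KY (t : Finset (Fin 6)) : G.conf t ∈ (sD ∩ openConn 0 1 ∩ sOᶜ) ↔ pKY t = true := by
  rw [Set.mem_inter_iff, Set.mem_inter_iff, mem_univ_iff, true_and, Set.mem_compl_iff, CrossReachMeasureCex.not_iff_bnot (open03_iff t)]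
  unfold pKY openConn; rw [Set.mem_setOf_eq, reach_iff, Bool.and_eq_true]
/-- Membership in `Y ∩ Z ∩ O`. -/
theorem mem_IYZ (t : Finset (Fin 6)) : G.conf t ∈ (sD ∩ openConn 0 1 ∩ openConn 0 2 ∩ sO) ↔ pIYZ t = true := by
  rw [Set.mem_inter_iff, Set.mem_inter_iff, Set.mem_inter_iff, mem_univ_iff, true_and, open03_iff t]
  unfold pIYZ openConn; rw [Set.mem_setOf_eq, Set.mem_setOf_eq, reach_iff, reach_iff, Bool.and_eq_true, Bool.and_eq_true]
/-- Membership in `Y ∩ O`. -/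
theorem mem_IY (t : Finset (Fin 6)) : G.conf t ∈ (sD ∩ openConn 0 1 ∩ sO) ↔ pIY t = true := by
  rw [Set.mem_inter_iff, Set.mem_inter_iff, mem_univ_iff, true_and, open03_iff t]
  unfold pIY openConn; rw [Set.mem_setOf_eq, reach_iff, Bool.and_eq_true]

/-! ### The ten masses as real numbers -/

/-- At `q = 1` the random-cluster measure of the listing is the Bernoulli product measure. [cite: Grimmett2006, §1.3] -/
theorem rc_eq : rcMeasureW G.w ((G.q : ℚ) : ℝ) ∅ = prodBernoulli G.w := by
  have : ((G.q : ℚ) : ℝ) = 1 := by norm_num [G]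
  rw [this]; exact rcMeasureW_one G.w ∅

/-- `I = μ(O)` exactly. -/
theorem real_I : (prodBernoulli G.w).real (sD ∩ sO) = ((4096 / 8192 : ℚ) : ℝ) := by
  have h := FK.RCEval.real_eq_massQ_div G_valid (mem_I)
  rw [rc_eq, massQ_eq_massW, mass_I, zq_eq, massW_true, div_one] at h; exact h
/-- `K = μ(Oᶜ)` exactly. -/
theorem real_K : (prodBernoulli G.w).real (sD ∩ sOᶜ) = ((4096 / 8192 : ℚ) : ℝ) := by
  have h := FK.RCEval.real_eq_massQ_div G_valid (mem_K)
  rw [rc_eq, massQ_eq_massW, mass_K, zq_eq, massW_true, div_one] at h; exact h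
/-- `μ(T)` exactly. -/
theorem real_T : (prodBernoulli G.w).real (sA ∩ sD) = ((4407 / 8192 : ℚ) : ℝ) := by
  have h := FK.RCEval.real_eq_massQ_div G_valid (mem_T)
  rw [rc_eq, massQ_eq_massW, mass_T, zq_eq, massW_true, div_one] at h; exact h
/-- `μ(T ∩ W)` exactly. -/
theorem real_TW : (prodBernoulli G.w).real (sA ∩ sD ∩ openConn 1 2) = ((31 / 8192 : ℚ) : ℝ) := by
  have h := FK.RCEval.real_eq_massQ_div G_valid (mem_TW)
  rw [rc_eq, massQ_eq_massW, mass_TW, zq_eq, massW_true, div_one] at h; exact h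
/-- `K_N` exactly. -/
theorem real_KN : (prodBernoulli G.w).real (sD ∩ (openConn 0 1)ᶜ ∩ sOᶜ) = ((2343 / 8192 : ℚ) : ℝ) := by
  have h := FK.RCEval.real_eq_massQ_div G_valid (mem_KN)
  rw [rc_eq, massQ_eq_massW, mass_KN, zq_eq, massW_true, div_one] at h; exact h
/-- `K_{Y∩Z}` exactly. -/
theorem real_KYZ : (prodBernoulli G.w).real (sD ∩ openConn 0 1 ∩ openConn 0 2 ∩ sOᶜ) = ((1654 / 8192 : ℚ) : ℝ) := by
  have h := FK.RCEval.real_eq_massQ_div G_valid (mem_KYZ)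
  rw [rc_eq, massQ_eq_massW, mass_KYZ, zq_eq, massW_true, div_one] at h; exact h
/-- `K_{N∩Z}` exactly. -/
theorem real_KNZ : (prodBernoulli G.w).real (sD ∩ (openConn 0 1)ᶜ ∩ openConn 0 2 ∩ sOᶜ) = ((2116 / 8192 : ℚ) : ℝ) := by
  have h := FK.RCEval.real_eq_massQ_div G_valid (mem_KNZ)
  rw [rc_eq, massQ_eq_massW, mass_KNZ, zq_eq, massW_true, div_one] at h; exact h
/-- `K_Y` exactly. -/
theorem real_KY : (prodBernoulli G.w).real (sD ∩ openConn 0 1 ∩ sOᶜ) = ((1753 / 8192 : ℚ) : ℝ) := by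
  have h := FK.RCEval.real_eq_massQ_div G_valid (mem_KY)
  rw [rc_eq, massQ_eq_massW, mass_KY, zq_eq, massW_true, div_one] at h; exact h
/-- `I_{Y∩Z}` exactly. -/
theorem real_IYZ : (prodBernoulli G.w).real (sD ∩ openConn 0 1 ∩ openConn 0 2 ∩ sO) = ((1905 / 8192 : ℚ) : ℝ) := by
  have h := FK.RCEval.real_eq_massQ_div G_valid (mem_IYZ)
  rw [rc_eq, massQ_eq_massW, mass_IYZ, zq_eq, massW_true, div_one] at h; exact h
/-- `I_Y` exactly. -/
theorem real_IY : (prodBernoulli G.w).real (sD ∩ openConn 0 1 ∩ sO) = ((2032 / 8192 : ℚ) : ℝ) := by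
  have h := FK.RCEval.real_eq_massQ_div G_valid (mem_IY)
  rw [rc_eq, massQ_eq_massW, mass_IY, zq_eq, massW_true, div_one] at h; exact h

/-! ### The cylinder functional of the edge `03` -/

open scoped Classical in
/-- `F(C) = 1{s(0,3) ∈ C}`: the indicator that the owner's cluster contains the edge `03` (a cylinder functional). -/
noncomputable def F (C : Set (Sym2 (Fin 5))) : ℝ := if s((0 : Fin 5), (3 : Fin 5)) ∈ C then 1 else 0

/-- The cylinder functional is monotone. [folklore] -/
theorem F_mono : Monotone F := by
  intro C C' h; unfold F
  by_cases hc : s((0 : Fin 5), (3 : Fin 5)) ∈ C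
  · rw [if_pos hc, if_pos (h hc)]
  · rw [if_neg hc]; split_ifs <;> norm_num

/-- The cylinder functional is nonnegative. [folklore] -/
theorem F_nonneg (C : Set (Sym2 (Fin 5))) : 0 ≤ F C := by unfold F; split_ifs <;> norm_num

/-- The cylinder functional is at most one. [folklore] -/
theorem F_le_one (C : Set (Sym2 (Fin 5))) : F C ≤ 1 := by unfold F; split_ifs <;> norm_num

/-- The edge `03` lies in the open edge cluster of `0` iff it is open. [folklore] -/
theorem mem_cluster_iff (ω : BondConfig (Fin 5)) : s((0 : Fin 5), (3 : Fin 5)) ∈ openEdgeCluster ω 0 ↔ s((0 : Fin 5), (3 : Fin 5)) ∈ ω := by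
  rw [mem_openEdgeCluster_iff]
  constructor
  · exact fun h => h.1
  · intro h
    have h03 : (0 : Fin 5) ≠ 3 := by decide
    refine ⟨h, ?_, ?_⟩
    · rw [Sym2.mk_isDiag_iff]; exact h03
    · intro v hv
      rcases Sym2.mem_iff.1 hv with rfl | rfl
      · exact SimpleGraph.Reachable.refl _
      · have hadj : (openGraph ω).Adj 0 3 := by
          unfold openGraph; rw [SimpleGraph.fromEdgeSet_adj]; exact ⟨h, h03⟩
        exact hadj.reachable

/-- Reading the cylinder functional on a configuration. [folklore] -/
theorem F_cluster (ω : BondConfig (Fin 5)) : F (openEdgeCluster ω 0) = sO.indicator 1 ω := by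
  unfold F
  by_cases h : s((0 : Fin 5), (3 : Fin 5)) ∈ ω
  · rw [if_pos ((mem_cluster_iff ω).2 h), Set.indicator_of_mem (show ω ∈ sO from h), Pi.one_apply]
  · rw [if_neg (fun h' => h ((mem_cluster_iff ω).1 h')), Set.indicator_of_notMem (show ω ∉ sO from h)]

/-- Reading `1 − F` on a configuration. [folklore] -/
theorem one_sub_F_cluster (ω : BondConfig (Fin 5)) : 1 - F (openEdgeCluster ω 0) = sOᶜ.indicator 1 ω := by
  rw [F_cluster]
  by_cases h : ω ∈ sO
  · rw [Set.indicator_of_mem h, Set.indicator_of_notMem (Set.notMem_compl_iff.2 h), Pi.one_apply, sub_self]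
  · rw [Set.indicator_of_notMem h, Set.indicator_of_mem (show ω ∈ sOᶜ from h), Pi.one_apply, sub_zero]

/-- `∫_S F(C_0) = μ(S ∩ O)` and `∫_S (1 − F(C_0)) = μ(S ∩ Oᶜ)`. [folklore] -/
theorem integral_F (S : Set (BondConfig (Fin 5))) :
    ∫ ω in S, F (openEdgeCluster ω 0) ∂(prodBernoulli G.w) = (prodBernoulli G.w).real (S ∩ sO) := by
  simp_rw [F_cluster]; exact TripodExchange.setIntegral_indicator_one_eq _ _ _

/-- `∫_S (1 − F(C_0)) = μ(S ∩ Oᶜ)`. [folklore] -/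
theorem integral_one_sub_F (S : Set (BondConfig (Fin 5))) :
    ∫ ω in S, (1 - F (openEdgeCluster ω 0)) ∂(prodBernoulli G.w) = (prodBernoulli G.w).real (S ∩ sOᶜ) := by
  simp_rw [one_sub_F_cluster]; exact TripodExchange.setIntegral_indicator_one_eq _ _ _

/-! ### The refutation -/

/-- **The marker split fails at the witness**: with `μ = prodBernoulli G.w`, `s = 0`, `y = 1`, `z = 2`, `X = ∅`, `F = 1{03 ∈ C}`:
`I·(μ(T)K_N K_{Y∩Z} − Γ K_Y) > K·(μ(T)K_N I_{Y∩Z} − Γ I_Y)`, `Γ = μ(T∩W)K_N + μ(T)K_{N∩Z}` (margin `3784113/2³⁷ = 2.75·10⁻⁵`).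
(this seat, gen 16) [cite: VandenbergHaggstromKahn2005, §2.1 pp. 10–13] -/
theorem markerSplit_lt :
    (∫ ω in sD, (1 - F (openEdgeCluster ω 0)) ∂(prodBernoulli G.w)) *
        ((prodBernoulli G.w).real (sA ∩ sD) *
            (∫ ω in sD ∩ (openConn 0 1)ᶜ, (1 - F (openEdgeCluster ω 0)) ∂(prodBernoulli G.w)) *
            (∫ ω in sD ∩ openConn 0 1 ∩ openConn 0 2, F (openEdgeCluster ω 0) ∂(prodBernoulli G.w)) -
          ((prodBernoulli G.w).real (sA ∩ sD ∩ openConn 1 2) *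
              (∫ ω in sD ∩ (openConn 0 1)ᶜ, (1 - F (openEdgeCluster ω 0)) ∂(prodBernoulli G.w)) +
            (prodBernoulli G.w).real (sA ∩ sD) *
              (∫ ω in sD ∩ (openConn 0 1)ᶜ ∩ openConn 0 2, (1 - F (openEdgeCluster ω 0)) ∂(prodBernoulli G.w))) *
          (∫ ω in sD ∩ openConn 0 1, F (openEdgeCluster ω 0) ∂(prodBernoulli G.w))) <
    (∫ ω in sD, F (openEdgeCluster ω 0) ∂(prodBernoulli G.w)) *
        ((prodBernoulli G.w).real (sA ∩ sD) *
            (∫ ω in sD ∩ (openConn 0 1)ᶜ, (1 - F (openEdgeCluster ω 0)) ∂(prodBernoulli G.w)) *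
            (∫ ω in sD ∩ openConn 0 1 ∩ openConn 0 2, (1 - F (openEdgeCluster ω 0)) ∂(prodBernoulli G.w)) -
          ((prodBernoulli G.w).real (sA ∩ sD ∩ openConn 1 2) *
              (∫ ω in sD ∩ (openConn 0 1)ᶜ, (1 - F (openEdgeCluster ω 0)) ∂(prodBernoulli G.w)) +
            (prodBernoulli G.w).real (sA ∩ sD) *
              (∫ ω in sD ∩ (openConn 0 1)ᶜ ∩ openConn 0 2, (1 - F (openEdgeCluster ω 0)) ∂(prodBernoulli G.w))) *
          (∫ ω in sD ∩ openConn 0 1, (1 - F (openEdgeCluster ω 0)) ∂(prodBernoulli G.w))) := by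
  rw [integral_F, integral_F, integral_F, integral_one_sub_F, integral_one_sub_F, integral_one_sub_F, integral_one_sub_F,
    integral_one_sub_F]
  rw [real_I, real_K, real_T, real_TW, real_KN, real_KYZ, real_KNZ, real_KY, real_IYZ, real_IY]
  norm_num

end MarkerSplitCex

/-- **THEOREM: the marker-split conjecture S0 is FALSE.**  `Consts.MarkerSplit` (every monotone `0 ≤ F ≤ 1` of `C_s` satisfies `K·C2 ≥ I·C0`,
i.e. `Cov_ν(U, Y∩Z) ≥ (p' + ν(Z|Uᶜ,N))·Cov_ν(U,Y)` for up-events) fails at `n = 5`, `X = ∅`, `s = 0`, `y = 1`, `z = 2`, weights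
`w(14) = w(03) = w(23) = 1/2`, `w(02) = 7/8`, `w(34) = 31/32`, `w(04) = 3/4`, `F = 1{03 ∈ C_s}` (`Consts.MarkerSplitCex.markerSplit_lt`).  The
positive-association term of the split identity `Consts.mdlx_markerSplit_identity` cannot be dropped; MDL(X)′ itself holds at the witness.
refuted-substantive. [cite: VandenbergHaggstromKahn2005, §2.1 pp. 10–13] -/
theorem not_markerSplit : ¬ MarkerSplit := by
  intro h
  have h5 := h 5 MarkerSplitCex.G.w 0 1 2 ∅ (by decide) MarkerSplitCex.F MarkerSplitCex.F_mono MarkerSplitCex.F_nonneg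
    MarkerSplitCex.F_le_one
  exact absurd h5 (not_le.2 MarkerSplitCex.markerSplit_lt)

end Consts

end Summit.CriticalPhenomena.PercolationContinuityZ3.Theorems
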